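import Summits.QuantumFields.YangMills.Theorems.BalabanUVNodesPortS1LZdetPiecesLocGauge
import Summits.QuantumFields.YangMills.Theorems.BalabanUVNodesPortS1Spaces

/-!
# NODE O port PT-A — ROW (b) FOR THE GAUSSIAN-BRACKET PIECES: `‖lzdetGPiece … X φ‖ ≤ E₀ e^{−κ d(X)}` at a pair of the record space of `X`, from the x-UNIFORM bound of `stub_G3C`'s resolvent pieces on
# `[0, R]` (cost `R·Bc`) and the polymer bound of the power members (✓`norm_powMemberPiece_le`) restricted to the pieces INSIDE `X` (a piece of `X` reads no other), with the torus volume law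
# `#X ≤ 5·2^d e^{d(X)}` converting `#X`-prefactors into two units of rate; and the unit-subtracted piece at `2E₀` (v3.3 glue `stub_LZdetGlue`, 27930 line `pta_residueW`)

Cell `ym-nodeO-ideate`, porter seat `ymgap-nodeO-port-PTA-1` (gen 7); `--supports stmt-QuantumFields-27930` (helper, P0-free).  [16] = [Balaban1985UV3], [I] = [Balaban1987RG1], [II] = [Balaban1988RG2Cluster].
* §1 `card_le_five_mul_exp`, `restrictedFamily` bookkeeping (`locPowPiece`∕`powMemberPiece` of `X` over the family cut to `Y ⊆ X` — `powMemberPiece_restrict`).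
* §2 ★★ `norm_lzdetGPiece_le` — ROW (b) for the unsubtracted piece with `E₀ := 13·4^d·(R·Bc + V)` and `κ := min κt (δ₀∕2) − 2`; ★★ `norm_lzdetPiece_le` — the subtracted piece at `2E₀` (the unit pair
  lies in every record space, ✓`encodeCfg_unitPair_mem_recordUc`).

HONEST FRAMING.  Real arithmetic over displayed clause shapes ((P4-Schur) ⇒ operator-norm decay is the wrapper's; (g3) of `G3CPiecesAt`); nothing of Bałaban asserted; `stub_P0C` ∕ `stub_G3C` ∕ `stub_LZdetGlue` ∕
`stub_FE` OPEN; 27930 OPEN (stubs 2∕6 by name) · no claim; NODE O 0∕1; COUNT 8∕28 · K 1∕4 UNMOVED; finite `𝕋⁴_{L^K}` at fixed ε — NOT continuum ∕ OS ∕ Clay; **the Yang–Mills mass gap is NOT proved by any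
of this.**  No `sorry`, no `def`, no `instance`; standard axioms.
-/

noncomputable section

open scoped BigOperators Matrix.Norms.L2Operator
open Finset

namespace Summit.QuantumFields.YangMills.Theorems.BalabanUVNodesPortS1

open Summit.QuantumFields.YangMills.Theorems.K0RecordFormatNames
open Literature.MathematicalPhysics.QuantumFieldTheory.Balaban1983to89
open Literature.MathematicalPhysics.QuantumFieldTheory.Balaban1983to89.Node00
open Literature.MathematicalPhysics.QuantumFieldTheory.Balaban1983to89.T4Continuum (T4Family)
open Literature.MathematicalPhysics.QuantumFieldTheory.Balaban1983to89.TreeLengthTorus (TPt IsTDom TDom torusTreeLen torusTreeLen_nonneg card_le_torusTreeLen)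
open Literature.MathematicalPhysics.QuantumFieldTheory.Balaban1983to89.B12TreeDecay (K₀ kappa₀)

/-! ## §1  Volume law; the family cut to the sub-domains of `X` -/

section Prelim

variable {d N : ℕ} [NeZero N]

/-- **Torus volume law, exponential form**: `#X ≤ 5·2^d·e^{d(X)}` for a localization domain. [cite: Balaban1988RG2Cluster, (2.30) p.18] -/
theorem card_le_five_mul_exp (X : TDom d N) : (X.1.card : ℝ) ≤ 5 * 2 ^ d * Real.exp (torusTreeLen X.1) := by
  have h := card_le_torusTreeLen X.2.1 X.2.2
  have ht := torusTreeLen_nonneg X.1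
  have he := Real.add_one_le_exp (torusTreeLen X.1)
  have h2d : (0 : ℝ) < 2 ^ d := by positivity
  nlinarith

variable {S : Type} [Fintype S] [DecidableEq S] [DecidableEq (TDom d N)]

/-- **A piece of `X` is the piece of the family CUT TO THE SUB-DOMAINS OF `X`** (pieces not inside `X` replaced by `0`). [cite: Balaban1987RG1, (1.7) p.261 (bookkeeping)] -/
theorem powMemberPiece_restrict (T : TDom d N → Matrix S S ℂ) (R : ℝ) (X : TDom d N) :
    powMemberPiece (fun Y : TDom d N => (Y.1 : Finset (TPt d N))) T R X.1 =
      powMemberPiece (fun Y : TDom d N => (Y.1 : Finset (TPt d N))) (fun Y => if (Y.1 : Finset (TPt d N)) ⊆ X.1 then T Y else 0) R X.1 :=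
  powMemberPiece_congr_of_subset _ (fun Y hY => by rw [if_pos hY]) R

/-- ★ **THE POWER PIECE OF `X` FROM BOUNDS INSIDE `X` ONLY**: operator-norm decay of the pieces `Y ⊆ X`, supports in the domains, `V` index points per cube, `κ₀(4·2^d,2d) ≤ δ∕2 − 1`, `R ≥ 2c(4·2^dK₀)e^δ`
⇒ `‖powMemberPiece … X‖ ≤ ½·(V·#X)·#X·e^{−(δ∕2) d(X)}`. [cite: Balaban1985UV3, (63) p.272, (25) p.262; Balaban1988RG2Cluster, (2.27) p.18, (1.26) p.8] -/
theorem norm_powMemberPiece_le_of_inside (cube : S → TPt d N) (T : TDom d N → Matrix S S ℂ) {c δ R : ℝ} {V : ℕ}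
    (hc : 0 ≤ c) (hδ : kappa₀ (4 * 2 ^ d) (2 * d) ≤ δ / 2 - 1) (hR : 0 < R) (hRc : 2 * (c * (4 * 2 ^ d * K₀ (4 * 2 ^ d) (2 * d)) * Real.exp δ) ≤ R)
    (hsupp : ∀ Y s s', (cube s ∉ (Y.1 : Finset (TPt d N)) ∨ cube s' ∉ (Y.1 : Finset (TPt d N))) → T Y s s' = 0)
    (hV : ∀ q : TPt d N, (univ.filter fun s : S => cube s = q).card ≤ V)
    (X : TDom d N) (hT : ∀ Y : TDom d N, (Y.1 : Finset (TPt d N)) ⊆ X.1 → ‖T Y‖ ≤ c * Real.exp (-(δ * torusTreeLen Y.1))) :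
    ‖powMemberPiece (fun Y : TDom d N => (Y.1 : Finset (TPt d N))) T R X.1‖ ≤ (1 / 2) * ((V : ℝ) * X.1.card) * X.1.card * Real.exp (-(δ / 2 * torusTreeLen X.1)) := by
  rw [powMemberPiece_restrict]
  have hδ0 : 0 ≤ δ := by
    have := B12TreeDecay.kappa₀_nonneg (by positivity : (0 : ℝ) ≤ 4 * 2 ^ d) (2 * d); linarith
  have hKc : 0 ≤ 4 * 2 ^ d * K₀ (4 * 2 ^ d) (2 * d) := by have := B12TreeDecay.K₀_pos (4 * 2 ^ d) (2 * d); positivity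
  set T' : TDom d N → Matrix S S ℂ := fun Y => if (Y.1 : Finset (TPt d N)) ⊆ X.1 then T Y else 0 with hT'
  have hsupp' : ∀ Y s s', (cube s ∉ (Y.1 : Finset (TPt d N)) ∨ cube s' ∉ (Y.1 : Finset (TPt d N))) → T' Y s s' = 0 := by
    intro Y s s' h; simp only [hT']; split_ifs
    · exact hsupp Y s s' h
    · rfl
  have hT'b : ∀ Y : TDom d N, ‖T' Y‖ ≤ c * Real.exp (-(δ * torusTreeLen (Y.1 : Finset (TPt d N)))) := by
    intro Y; simp only [hT']; split_ifs with h
    · exact hT Y h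
    · rw [norm_zero]; positivity
  have hmain := norm_powMemberPiece_le (cube := cube) (supp := fun Y : TDom d N => (Y.1 : Finset (TPt d N))) (T := T')
    (fun Y => Y.2) hsupp' hc hδ0 hKc hR hRc hT'b (fun Y => touchSum_torus_le (d := d) (N := N) hδ Y) X.1
  refine hmain.trans ?_
  -- N_X ≤ V · #X
  have hN : ((univ.filter fun s : S => cube s ∈ (X.1 : Finset (TPt d N))).card : ℝ) ≤ (V : ℝ) * X.1.card := by
    have h : (univ.filter fun s : S => cube s ∈ (X.1 : Finset (TPt d N))) = (X.1 : Finset (TPt d N)).biUnion (fun q => univ.filter fun s : S => cube s = q) := by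
      ext s; simp [mem_biUnion, mem_filter]
    rw [h]
    calc (((X.1 : Finset (TPt d N)).biUnion (fun q => univ.filter fun s : S => cube s = q)).card : ℝ)
        ≤ ∑ q ∈ (X.1 : Finset (TPt d N)), ((univ.filter fun s : S => cube s = q).card : ℝ) := by exact_mod_cast card_biUnion_le
      _ ≤ ∑ _q ∈ (X.1 : Finset (TPt d N)), (V : ℝ) := sum_le_sum fun q _ => by exact_mod_cast hV q
      _ = (V : ℝ) * X.1.card := by rw [sum_const, nsmul_eq_mul, mul_comm]
  have hE : 0 ≤ Real.exp (-(δ / 2 * torusTreeLen (X.1 : Finset (TPt d N)))) := Real.exp_nonneg _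
  have hXc : (0 : ℝ) ≤ X.1.card := Nat.cast_nonneg _
  nlinarith [mul_nonneg (mul_nonneg hXc hE) (sub_nonneg.2 hN)]

end Prelim

/-! ## §2  ★★ ROW (b) -/

section Bound

variable (F : T4Family)

open scoped Classical in
/-- ★★ **ROW (b) FOR THE UNSUBTRACTED PIECE**: at a pair `φ`, if the resolvent pieces obey `‖EG x X φ‖ ≤ Bc·#X·e^{−κt d(X)}` on `[0, R]` ((g3)), the non-b₀ blocks of the carrier pieces INSIDE `X` obey
`‖·‖ ≤ c₀ e^{−δ₀ d(Y)}` ((P4-Schur) at `φ`), supports sit in the domains through a cube map with `≤ V` index points per cube, `κ₀(64,8)`-type threshold `≤ δ₀∕2 − 1`, `0 < R`, `R ≥ 2c₀(4·2^dK₀)e^{δ₀}`,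
`0 ≤ Bc`, then `‖G_X(φ)‖ ≤ 13·4^d·(R·Bc + V)·e^{−(min κt (δ₀∕2) − 2)·d(X)}`. [cite: Balaban1985UV3, (63) p.272, (25) p.262; Balaban1987RG1, (1.18) p.263; Balaban1988RG2Cluster, (2.30) p.18] -/
theorem norm_lzdetGPiece_le (Mc k K : ℕ)
    (TYK : (recordDomSys F Mc k K).Dom → Sect2.CPair (F.P K) (MatA 2) → FluctIdx F k K → FluctIdx F k K → ℂ)
    (EGK : ℝ → (recordDomSys F Mc k K).Dom → Sect2.CPair (F.P K) (MatA 2) → ℂ)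
    (cube : NonB0Idx F k K → TPt (F.P K).d (Sect2.domCount (F.P K) Mc (k + 1)))
    {R Bc κt c₀ δ₀ : ℝ} {V : ℕ} (hR : 0 < R) (hBc : 0 ≤ Bc) (hc₀ : 0 ≤ c₀)
    (hδ : kappa₀ (4 * 2 ^ (F.P K).d) (2 * (F.P K).d) ≤ δ₀ / 2 - 1)
    (hRc : 2 * (c₀ * (4 * 2 ^ (F.P K).d * K₀ (4 * 2 ^ (F.P K).d) (2 * (F.P K).d)) * Real.exp δ₀) ≤ R)
    (hsupp : ∀ Y φ (s s' : NonB0Idx F k K),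
      (cube s ∉ (Y.1 : Finset (TPt (F.P K).d (Sect2.domCount (F.P K) Mc (k + 1)))) ∨ cube s' ∉ (Y.1 : Finset (TPt (F.P K).d (Sect2.domCount (F.P K) Mc (k + 1))))) →
        TYK Y φ s.1 s'.1 = 0)
    (hV : ∀ q, (univ.filter fun s : NonB0Idx F k K => cube s = q).card ≤ V)
    (X : (recordDomSys F Mc k K).Dom) (φ : Sect2.CPair (F.P K) (MatA 2))
    (hEGb : ∀ x ∈ Set.Icc (0 : ℝ) R, ‖EGK x X φ‖ ≤ Bc * (X.1.card : ℝ) * Real.exp (-(κt * (recordDomSys F Mc k K).dj X)))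
    (hTYb : ∀ Y : (recordDomSys F Mc k K).Dom, (Y.1 : Finset _) ⊆ X.1 →
      ‖nonB0Block F k K (TYK Y φ)‖ ≤ c₀ * Real.exp (-(δ₀ * torusTreeLen (Y.1 : Finset (TPt (F.P K).d (Sect2.domCount (F.P K) Mc (k + 1))))))) :
    ‖lzdetGPiece F Mc k K TYK EGK R X φ‖ ≤ 13 * 4 ^ (F.P K).d * (R * Bc + V) * Real.exp (-((min κt (δ₀ / 2) - 2) * (recordDomSys F Mc k K).dj X)) := by
  have hdj : (recordDomSys F Mc k K).dj X = torusTreeLen (X.1 : Finset (TPt (F.P K).d (Sect2.domCount (F.P K) Mc (k + 1)))) := rfl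
  set t : ℝ := torusTreeLen (X.1 : Finset (TPt (F.P K).d (Sect2.domCount (F.P K) Mc (k + 1)))) with ht
  have ht0 : 0 ≤ t := torusTreeLen_nonneg _
  have hcard : ((X.1 : Finset _).card : ℝ) ≤ 5 * 2 ^ (F.P K).d * Real.exp t := card_le_five_mul_exp X
  -- the resolvent member
  have hint : ‖∫ x in (0 : ℝ)..R, EGK x X φ‖ ≤ Bc * (X.1.card : ℝ) * Real.exp (-(κt * t)) * |R - 0| := by
    refine intervalIntegral.norm_integral_le_of_norm_le_const fun x hx => ?_
    rw [Set.uIoc_of_le hR.le] at hx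
    rw [← hdj]
    exact hEGb x ⟨hx.1.le, hx.2⟩
  rw [sub_zero, abs_of_pos hR] at hint
  -- the power member
  have hpow := norm_powMemberPiece_le_of_inside (S := NonB0Idx F k K) cube (fun Y => nonB0Block F k K (TYK Y φ)) hc₀ hδ hR hRc
    (fun Y s s' h => by simp only [nonB0Block, Matrix.of_apply]; exact hsupp Y φ s s' h) hV X hTYb
  -- assemble
  have hexp1 : Real.exp (-(κt * t)) ≤ Real.exp (-(min κt (δ₀ / 2)) * t) :=
    Real.exp_le_exp.2 (by nlinarith [min_le_left κt (δ₀ / 2)])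
  have hexp2 : Real.exp (-(δ₀ / 2 * t)) ≤ Real.exp (-(min κt (δ₀ / 2)) * t) :=
    Real.exp_le_exp.2 (by nlinarith [min_le_right κt (δ₀ / 2)])
  have hsplit : Real.exp (-((min κt (δ₀ / 2) - 2) * t)) = Real.exp (-(min κt (δ₀ / 2)) * t) * (Real.exp t * Real.exp t) := by
    rw [← Real.exp_add, ← Real.exp_add]; congr 1; ring
  have hG : ‖lzdetGPiece F Mc k K TYK EGK R X φ‖ ≤ (1 / 2) * (Bc * (X.1.card : ℝ) * Real.exp (-(κt * t)) * R)
      + (1 / 2) * ((V : ℝ) * X.1.card) * X.1.card * Real.exp (-(δ₀ / 2 * t)) := by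
    unfold lzdetGPiece
    refine (norm_add_le _ _).trans (add_le_add ?_ hpow)
    rw [norm_mul, show ‖(1 / 2 : ℂ)‖ = 1 / 2 by norm_num]
    exact mul_le_mul_of_nonneg_left hint (by norm_num)
  refine hG.trans ?_
  rw [hdj, hsplit]
  have h4 : (4 : ℝ) ^ (F.P K).d = 2 ^ (F.P K).d * 2 ^ (F.P K).d := by rw [← mul_pow]; norm_num
  have hE0 : 0 ≤ Real.exp (-(min κt (δ₀ / 2)) * t) := Real.exp_nonneg _
  have het : 1 ≤ Real.exp t := Real.one_le_exp ht0
  have hXc : (0 : ℝ) ≤ X.1.card := Nat.cast_nonneg _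
  have hV0 : (0 : ℝ) ≤ V := Nat.cast_nonneg _
  have h2d : (1 : ℝ) ≤ 2 ^ (F.P K).d := one_le_pow₀ (by norm_num)
  -- term 1
  have hA : (1 / 2) * (Bc * (X.1.card : ℝ) * Real.exp (-(κt * t)) * R)
      ≤ 3 * 4 ^ (F.P K).d * (R * Bc) * (Real.exp (-(min κt (δ₀ / 2)) * t) * (Real.exp t * Real.exp t)) := by
    calc (1 / 2) * (Bc * (X.1.card : ℝ) * Real.exp (-(κt * t)) * R)
        = (1 / 2) * (R * Bc) * ((X.1.card : ℝ) * Real.exp (-(κt * t))) := by ring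
      _ ≤ (1 / 2) * (R * Bc) * ((5 * 2 ^ (F.P K).d * Real.exp t) * Real.exp (-(min κt (δ₀ / 2)) * t)) := by
          refine mul_le_mul_of_nonneg_left (mul_le_mul hcard hexp1 (Real.exp_nonneg _) (by positivity)) (by positivity)
      _ ≤ 3 * 4 ^ (F.P K).d * (R * Bc) * (Real.exp (-(min κt (δ₀ / 2)) * t) * (Real.exp t * Real.exp t)) := by
          rw [h4]
          have a1 : (2 : ℝ) ^ (F.P K).d ≤ 2 ^ (F.P K).d * 2 ^ (F.P K).d := le_mul_of_one_le_right (by positivity) h2d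
          have a2 : Real.exp t ≤ Real.exp t * Real.exp t := le_mul_of_one_le_right (by positivity) het
          have a3 : (2 : ℝ) ^ (F.P K).d * Real.exp t ≤ (2 ^ (F.P K).d * 2 ^ (F.P K).d) * (Real.exp t * Real.exp t) :=
            mul_le_mul a1 a2 (by positivity) (by positivity)
          have hbase : 5 * 2 ^ (F.P K).d * Real.exp t ≤ 6 * (2 ^ (F.P K).d * 2 ^ (F.P K).d) * (Real.exp t * Real.exp t) := by
            nlinarith [a3, mul_nonneg (le_trans zero_le_one h2d) (Real.exp_nonneg t)]
          have hnn : 0 ≤ (1 / 2) * (R * Bc) * Real.exp (-(min κt (δ₀ / 2)) * t) := by positivity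
          calc (1 / 2) * (R * Bc) * ((5 * 2 ^ (F.P K).d * Real.exp t) * Real.exp (-(min κt (δ₀ / 2)) * t))
              = ((1 / 2) * (R * Bc) * Real.exp (-(min κt (δ₀ / 2)) * t)) * (5 * 2 ^ (F.P K).d * Real.exp t) := by ring
            _ ≤ ((1 / 2) * (R * Bc) * Real.exp (-(min κt (δ₀ / 2)) * t)) * (6 * (2 ^ (F.P K).d * 2 ^ (F.P K).d) * (Real.exp t * Real.exp t)) :=
                mul_le_mul_of_nonneg_left hbase hnn
            _ = 3 * (2 ^ (F.P K).d * 2 ^ (F.P K).d) * (R * Bc) * (Real.exp (-(min κt (δ₀ / 2)) * t) * (Real.exp t * Real.exp t)) := by ring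
  -- term 2
  have hB : (1 / 2) * ((V : ℝ) * X.1.card) * X.1.card * Real.exp (-(δ₀ / 2 * t))
      ≤ 13 * 4 ^ (F.P K).d * (V : ℝ) * (Real.exp (-(min κt (δ₀ / 2)) * t) * (Real.exp t * Real.exp t)) := by
    calc (1 / 2) * ((V : ℝ) * X.1.card) * X.1.card * Real.exp (-(δ₀ / 2 * t))
        = (1 / 2) * (V : ℝ) * ((X.1.card : ℝ) * X.1.card) * Real.exp (-(δ₀ / 2 * t)) := by ring
      _ ≤ (1 / 2) * (V : ℝ) * ((5 * 2 ^ (F.P K).d * Real.exp t) * (5 * 2 ^ (F.P K).d * Real.exp t)) * Real.exp (-(min κt (δ₀ / 2)) * t) := by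
          refine mul_le_mul (mul_le_mul_of_nonneg_left (mul_le_mul hcard hcard hXc (by positivity)) (by positivity)) hexp2 (Real.exp_nonneg _) (by positivity)
      _ = (25 / 2) * 4 ^ (F.P K).d * (V : ℝ) * (Real.exp (-(min κt (δ₀ / 2)) * t) * (Real.exp t * Real.exp t)) := by rw [h4]; ring
      _ ≤ 13 * 4 ^ (F.P K).d * (V : ℝ) * (Real.exp (-(min κt (δ₀ / 2)) * t) * (Real.exp t * Real.exp t)) := by
          refine mul_le_mul_of_nonneg_right ?_ (by positivity)
          nlinarith [mul_nonneg (le_trans zero_le_one (one_le_pow₀ (by norm_num : (1:ℝ) ≤ 4) : (1:ℝ) ≤ 4 ^ (F.P K).d)) hV0]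
  calc _ ≤ _ := add_le_add hA hB
    _ ≤ 13 * 4 ^ (F.P K).d * (R * Bc + V) * (Real.exp (-(min κt (δ₀ / 2)) * t) * (Real.exp t * Real.exp t)) := by
        have : 0 ≤ R * Bc := by positivity
        nlinarith [mul_nonneg (mul_nonneg this hE0) (mul_nonneg (Real.exp_nonneg t) (Real.exp_nonneg t)),
          one_le_pow₀ (by norm_num : (1:ℝ) ≤ 4) (n := (F.P K).d)]

open scoped Classical in
/-- ★★ **ROW (b) FOR THE SUBTRACTED PIECE at `2E₀`** (the unit pair satisfies the same hypotheses). [cite: Balaban1987RG1, (1.18) p.263, (2.12)–(2.14) p.268] -/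
theorem norm_lzdetPiece_le (Mc k K : ℕ)
    (TYK : (recordDomSys F Mc k K).Dom → Sect2.CPair (F.P K) (MatA 2) → FluctIdx F k K → FluctIdx F k K → ℂ)
    (EGK : ℝ → (recordDomSys F Mc k K).Dom → Sect2.CPair (F.P K) (MatA 2) → ℂ)
    (cube : NonB0Idx F k K → TPt (F.P K).d (Sect2.domCount (F.P K) Mc (k + 1)))
    {R Bc κt c₀ δ₀ : ℝ} {V : ℕ} (hR : 0 < R) (hBc : 0 ≤ Bc) (hc₀ : 0 ≤ c₀)
    (hδ : kappa₀ (4 * 2 ^ (F.P K).d) (2 * (F.P K).d) ≤ δ₀ / 2 - 1)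
    (hRc : 2 * (c₀ * (4 * 2 ^ (F.P K).d * K₀ (4 * 2 ^ (F.P K).d) (2 * (F.P K).d)) * Real.exp δ₀) ≤ R)
    (hsupp : ∀ Y φ (s s' : NonB0Idx F k K),
      (cube s ∉ (Y.1 : Finset (TPt (F.P K).d (Sect2.domCount (F.P K) Mc (k + 1)))) ∨ cube s' ∉ (Y.1 : Finset (TPt (F.P K).d (Sect2.domCount (F.P K) Mc (k + 1))))) →
        TYK Y φ s.1 s'.1 = 0)
    (hV : ∀ q, (univ.filter fun s : NonB0Idx F k K => cube s = q).card ≤ V)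
    (X : (recordDomSys F Mc k K).Dom) (φ : Sect2.CPair (F.P K) (MatA 2))
    (hEGb : ∀ ψ ∈ ({φ, unitCPair F K} : Set (Sect2.CPair (F.P K) (MatA 2))), ∀ x ∈ Set.Icc (0 : ℝ) R,
      ‖EGK x X ψ‖ ≤ Bc * (X.1.card : ℝ) * Real.exp (-(κt * (recordDomSys F Mc k K).dj X)))
    (hTYb : ∀ ψ ∈ ({φ, unitCPair F K} : Set (Sect2.CPair (F.P K) (MatA 2))), ∀ Y : (recordDomSys F Mc k K).Dom, (Y.1 : Finset _) ⊆ X.1 →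
      ‖nonB0Block F k K (TYK Y ψ)‖ ≤ c₀ * Real.exp (-(δ₀ * torusTreeLen (Y.1 : Finset (TPt (F.P K).d (Sect2.domCount (F.P K) Mc (k + 1))))))) :
    ‖lzdetPiece F Mc k K TYK EGK R X φ‖ ≤ 2 * (13 * 4 ^ (F.P K).d * (R * Bc + V)) * Real.exp (-((min κt (δ₀ / 2) - 2) * (recordDomSys F Mc k K).dj X)) := by
  unfold lzdetPiece
  have h1 := norm_lzdetGPiece_le F Mc k K TYK EGK cube hR hBc hc₀ hδ hRc hsupp hV X φ (hEGb φ (by simp)) (hTYb φ (by simp))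
  have h2 := norm_lzdetGPiece_le F Mc k K TYK EGK cube hR hBc hc₀ hδ hRc hsupp hV X (unitCPair F K) (hEGb _ (by simp)) (hTYb _ (by simp))
  calc _ ≤ _ := norm_sub_le _ _
    _ ≤ _ := add_le_add h1 h2
    _ = _ := by ring

end Bound

end Summit.QuantumFields.YangMills.Theorems.BalabanUVNodesPortS1

end
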